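import Summits.RiemannHypothesis.RiemannHypothesis.Theorems.GroundBartaEvenWinsBeyondArchDeflationP72EEvenLowerGW
import Summits.RiemannHypothesis.RiemannHypothesis.Theorems.GroundBartaEvenWinsBeyondArchDeflationM72OddLower
import Summits.RiemannHypothesis.RiemannHypothesis.Theorems.MotivicDoorRungs
import Summits.RiemannHypothesis.RiemannHypothesis.Theorems.GroundBartaEvenWinsBeyondArchDeflationM72Common
import Literature.NumberTheory.LFunctions.WeilOddGroundState
import Literature.NumberTheory.LFunctions.WeilGroundEnergyParitySplit
import HarnessLib

/-!
# RiemannHypothesis — **Weil positivity on the full two-prime window**: `WeilPositivityOn (Real.log 2)` (and `18/25`), RH-free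

Helper file (`--supports stmt-RiemannHypothesis-18085`; rung R4a/R4b of the pub-rhdoor LADDER `Theorems/MotivicDoorRungs.lean`, the
registered stub `stub_headRung_log2 : NextRung` of the GronwallLeakage line `Cruxes/GronwallLeakage/Lines/exact_rung_log2.lean`, the
exact rung at `log 2` of route WeilPos), RH-free, axioms standard.  Prover B, speedrun unit `sr-gb-rung-b` (gen 5).

Weil's quadratic form `Q(g ⋆ g̃)` is non-negative for every test function supported in `[-18/25, 18/25]` (multiplicatively
`[e^{-0.72}, e^{0.72}] ⊋ [1/2, 2]`: the prime powers `2, 3, 4` lie inside), hence on `[-log 2, log 2]`.  In print the window of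
unconditional Weil positivity is `(log 2)/2` (Yoshida 1992, Thm 1; Connes–Consani 2021, the archimedean place); the tree's previous
frontier was `59/100` (`weilPositivityOn_59_100`, two-prime moment certificate `weilCert23P`).

Proof = the two sector blocks at `c = 18/25` (`weilGroundEnergy_eq_min_even_odd`, `dt_weilPositivityOn`):
* EVEN: `10⁻¹⁵ ≤ ε_ev(18/25)` — `m72E_evenLower_litW` (file …DeflationP72EEvenLowerGW: even-block rank-one two-prime certificate E72
  `β₂₃ = 17/25`, A-layer of six even degree-54 Ritz vectors, prover B's certified weighted residual Gram bounds RM72E, kernel LDL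
  certificate; the deflated Temple / Lehmann–Maehly criterion `dt_weilEvenGroundEnergy_ge_of_deflCert_w`);
* ODD: `1.1·10⁻¹¹ ≤ ε_od(18/25)` — `m72_oddLower_lit` (parity-ladder cell `[2/3, 18/25]`, provers A/B gen 2–4), transported to every
  `c ≤ 18/25` by `weilOddGroundEnergy_antitone` (Bombieri's monotonicity of the sector bottoms).

* `weilOddGroundEnergy_nonneg_of_le_M72`, `weilEvenGroundEnergy_M72_pos`, `weilGroundEnergy_M72_pos` (`ε(18/25) ≥ 10⁻¹⁵ > 0`);
* **`weilPositivityOn_M72 : WeilPositivityOn (18/25)`**, **`weilPositivityOn_log_two : WeilPositivityOn (Real.log 2)`**,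
  `weilPositivityOn_of_le_M72` (every window `a ≤ 18/25`);
* `weilGroundEnergy_M72_ge`, `weilGroundEnergy_ge_of_le_M72`, `weilGroundEnergy_pos_of_le_M72`, `weilGroundEnergy_log_two_pos`:
  `10⁻¹⁵ ≤ ε(c)` and `0 < ε(c)` for every `0 < c ≤ 18/25` (antitonicity `weilGroundEnergy_anti`).
-/

set_option linter.dupNamespace false

noncomputable section

open Set

namespace Summit.RiemannHypothesis.RiemannHypothesis.Theorems.EvenWinsBeyondArch

open Literature.NumberTheory.LFunctions

/-- **The odd block below `18/25`**: `0 ≤ ε_od(c)` for `0 < c ≤ 18/25` (from `1.1·10⁻¹¹ ≤ ε_od(18/25)` and antitonicity). [folklore] -/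
theorem weilOddGroundEnergy_nonneg_of_le_M72 {c : ℝ} (hc : 0 < c) (hc' : c ≤ 18 / 25) : 0 ≤ weilOddGroundEnergy c := by
  have h1 := m72_oddLower_lit.2
  have h2 := weilOddGroundEnergy_antitone hc hc'
  have h3 : (0 : ℝ) ≤ 11 / 1000000000000 := by norm_num
  linarith

/-- **The even block at `18/25`**: `0 < ε_ev(18/25)` (`≥ 10⁻¹⁵`, the deflated Temple even-sector certificate). [folklore] -/
theorem weilEvenGroundEnergy_M72_pos : 0 < weilEvenGroundEnergy (18 / 25 : ℝ) := by
  have h := m72E_evenLower_litW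
  have h0 : (0 : ℝ) < 1 / 1000000000000000 := by norm_num
  linarith

/-- `ε(18/25) = min(ε_ev, ε_od)(18/25) ≥ 10⁻¹⁵ > 0`: the bottom of Weil's form on the window `[-18/25, 18/25]` is positive. [folklore] -/
theorem weilGroundEnergy_M72_pos : 0 < weilGroundEnergy (18 / 25 : ℝ) := by
  rw [weilGroundEnergy_eq_min_even_odd]
  have hod : (0 : ℝ) < weilOddGroundEnergy (18 / 25 : ℝ) := by
    have h1 := m72_oddLower_lit.2
    have h3 : (0 : ℝ) < 11 / 1000000000000 := by norm_num
    linarith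
  exact lt_min weilEvenGroundEnergy_M72_pos hod

/-- **Weil positivity on the window `18/25`** (`e^{2·18/25} ≈ 4.22`: prime powers `2, 3, 4` inside): `0 ≤ Re Q(g ⋆ g̃)` for every
test function `g` with `tsupport g ⊆ [-18/25, 18/25]`.  RH-free. [folklore] -/
theorem weilPositivityOn_M72 : WeilPositivityOn (18 / 25 : ℝ) :=
  dt_weilPositivityOn weilEvenGroundEnergy_M72_pos.le (weilOddGroundEnergy_nonneg_of_le_M72 (by norm_num) le_rfl)

/-- **Weil positivity on the full two-prime window `log 2`** (`λ² = e^{2 log 2} = 4`; rhdoor LADDER R4a, GronwallLeakage `NextRung`,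
the exact rung at `log 2` of route WeilPos).  RH-free. [folklore] -/
theorem weilPositivityOn_log_two : WeilPositivityOn (Real.log 2) := by
  have h2 := m72_log2_lt
  push_cast at h2
  exact MotivicDoor.Rungs.rung_R4a_of_blocks_ge h2.le weilEvenGroundEnergy_M72_pos.le
    (weilOddGroundEnergy_nonneg_of_le_M72 (by norm_num) le_rfl)

/-- Every window `a ≤ 18/25` is a positivity window. [folklore] -/
theorem weilPositivityOn_of_le_M72 {a : ℝ} (ha : a ≤ 18 / 25) : WeilPositivityOn a :=
  weilPositivityOn_M72.mono ha

/-- **Quantitative window bottom at `18/25`**: `10⁻¹⁵ ≤ ε(18/25) = min(ε_ev, ε_od)(18/25)` (even block `10⁻¹⁵`, odd block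
`1.1·10⁻¹¹`). [folklore] -/
theorem weilGroundEnergy_M72_ge : (1 / 1000000000000000 : ℝ) ≤ weilGroundEnergy (18 / 25 : ℝ) := by
  rw [weilGroundEnergy_eq_min_even_odd]
  have hod : (1 / 1000000000000000 : ℝ) ≤ weilOddGroundEnergy (18 / 25 : ℝ) := by
    have h1 := m72_oddLower_lit.2
    have h3 : (1 / 1000000000000000 : ℝ) ≤ 11 / 1000000000000 := by norm_num
    linarith
  exact le_min m72E_evenLower_litW.2 hod

/-- **The window bottom is bounded below by `10⁻¹⁵` on every window `0 < c ≤ 18/25`** (`ε` is antitone in the window,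
`weilGroundEnergy_anti`). [folklore] -/
theorem weilGroundEnergy_ge_of_le_M72 {c : ℝ} (hc : 0 < c) (hc' : c ≤ 18 / 25) :
    (1 / 1000000000000000 : ℝ) ≤ weilGroundEnergy c :=
  weilGroundEnergy_M72_ge.trans (weilGroundEnergy_anti hc hc')

/-- **Strict positivity of the window bottom on `(0, 18/25]`**: `0 < ε(c)` for every `0 < c ≤ 18/25` — the coercive
anchor of the leakage cruxes (`ε > 0` region) now reaches past the two-prime window `log 2`.  RH-free. [folklore] -/
theorem weilGroundEnergy_pos_of_le_M72 {c : ℝ} (hc : 0 < c) (hc' : c ≤ 18 / 25) : 0 < weilGroundEnergy c :=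
  weilGroundEnergy_M72_pos.trans_le (weilGroundEnergy_anti hc hc')

/-- In particular `0 < ε(log 2)`: the bottom of Weil's form on the full two-prime window is strictly positive. [folklore] -/
theorem weilGroundEnergy_log_two_pos : 0 < weilGroundEnergy (Real.log 2) := by
  have h2 := m72_log2_lt
  push_cast at h2
  exact weilGroundEnergy_pos_of_le_M72 (Real.log_pos (by norm_num)) h2.le

end Summit.RiemannHypothesis.RiemannHypothesis.Theorems.EvenWinsBeyondArch

end
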